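import Summits.BirchSwinnertonDyer.BirchSwinnertonDyer.Theses.PAdicOrderV2
import Summits.BirchSwinnertonDyer.BirchSwinnertonDyer.Theses.SelmerRank
import Summits.BirchSwinnertonDyer.BirchSwinnertonDyer.Theorems.PAdicOrderV2PAdicOrderComparisonR2OfItemsControlTwo
import Literature.NumberTheory.EllipticCurves.SelmerCorankControlRatOrdinaryProofs
import Literature.NumberTheory.EllipticCurves.KatoRankBound

/-!
# Crux #2 `PAdicOrderComparisonR2` — skeleton v13 of line `Sketch` made sorry-free in its hypotheses
# (lead c4 — helper file, `--supports stmt-BirchSwinnertonDyer-0489`)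

Skeleton v13 (`Cruxes/PAdicOrderComparisonR2/Lines/Sketch.lean`, 2026-08-17) reduces crux #2
(`ord_{T=0} L_p(E,T) = ord_{s=1} L(E,s)` at every good ordinary `p`) to SIX route items —
`SelmerRankLB` / `SelmerRankUB` / `SelmerRankSmallImage` / `SelmerRankShaPFinite` (route SelmerRank:
whence `corank_{ℤ_p} Sel_{p^∞}(E/ℚ) = r_an` and `rank E(ℚ) = r_an` at every `p`), crux #4
`PAdicOrderSemisimpleR3` (stmt-0509, `p ≠ 2`) and crux #7 `PAdicOrderMainConjectureR7` (stmt-15426,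
`3 ≤ p`) — and, at `p = 2` only, the two stubs it SHARES VERBATIM with crux #3's line
(`Cruxes/PAdicOrderPadicBSDrankR2/Lines/Sketch.lean` v5.1): K2 (Kato's Thm 18.4 at every good
ordinary prime, the ∀-closure of the vendored named fact
`kato_selmerCorank_le_order_padicLFunction_allPrimes` — literature debt) and NE2⁺ (no excess zeros
at `p = 2` in positive rank, `ord_T L_2 ≤ corank Sel_{2^∞}` — open beyond print). Crux #5
`PAdicOrderRankOneR4` (rank one), an item hypothesis of v1–v12, is no longer used.

This file is that skeleton with the stubs turned into hypotheses, plus its slices: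

* `order_eq_selmerCorank_of_mc_ss_at` — the pointwise core at ANY prime: the main-conjecture
  conclusion and integral `T`-semisimplicity for every cyclotomic datum at `(W, p)` give
  `ord_{T=0} L_p(E,T) = corank_{ℤ_p} Sel_{p^∞}(E/ℚ)` (landed SS-bridge `stub_ker_mulTRat_sq_eq`,
  bookkeeping `stub_order_eq_selmerCorank`, Mazur control DISCHARGED in tree as
  `Greenberg1999_coinvariantsRank_eq_selmerCorank_rat_holds`) — no Literature hypothesis;
* `order_eq_analyticRank_odd_of_sixRouteItems` — crux #2 at every ODD good ordinary `p` from the six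
  items, every analytic rank (v12 needed seven: crux #5 dropped);
* `order_eq_analyticRank_five_le_of_fiveRouteItems` — crux #2 at every good ordinary `p ≥ 5` from
  FIVE items (no `SelmerRankShaPFinite`: at `p ≥ 5` the Selmer side at `p` is LB/UB/SmallImage at `p`);
* `order_eq_analyticRank_two_of_kato_noExcess` — the `p = 2` residue from K2 and NE2⁺ AT THE POINT
  `(W, 2, f)` and the four SelmerRank items: rank 0 by interpolation (S1), `≤` by NE2⁺, `≥` by S1
  (rank 1) / parity L2 (rank 2) / K2 (rank `≥ 3`);
* `pAdicOrderComparisonR2_of_sixRouteItems_kato_noExcessTwo` — the CRUX BY NAME from the six items,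
  the ∀-closure K2 and NE2⁺ (verbatim the registered stubs `stub_katoAllPrimes`, `stub_noExcessTwoPos`).

References: B. Mazur, J. Tate, J. Teitelbaum, Invent. Math. 84 (1986), §II.10; R. Greenberg, LNM
1716 (1999), Thm 1.2 and §1 Conj. 1.12–1.13; K. Kato, Astérisque 295 (2004), Thm 18.4 (p. 281).
-/

-- the problem directory `BirchSwinnertonDyer/BirchSwinnertonDyer` forces the duplicated namespace segment
set_option linter.dupNamespace false

namespace Summit.BirchSwinnertonDyer.BirchSwinnertonDyer.Theorems

open Summit.BirchSwinnertonDyer.BirchSwinnertonDyer.Theses.PAdicOrderV2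
open Summit.BirchSwinnertonDyer.BirchSwinnertonDyer.Theses.SelmerRank (SelmerRankLB SelmerRankUB
  SelmerRankSmallImage SelmerRankShaPFinite)
open Literature.NumberTheory.EllipticCurves

/-- **`ord_{T=0} L_p(E,T) = corank_{ℤ_p} Sel_{p^∞}(E/ℚ)` at a good ordinary `(W, p)` from the main
conjecture and `T`-semisimplicity AT THAT PRIME — any prime, any rank, no Literature hypothesis.**
Given, for every cyclotomic datum `(κ, γ, D)` at `p`, the main-conjecture conclusion (`X` torsion,
`char_Λ X = (g)`, `ι g = p^k · L_p`) and integral `T`-semisimplicity of `X` (`p^k T² x = 0 ⇒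
p^{k'} T x = 0`): `ord_T L_p = ord_T g = rank_{ℤ_p} X/TX` (structure theory under semisimplicity,
the landed SS-bridge `stub_ker_mulTRat_sq_eq` and bookkeeping `stub_order_eq_selmerCorank`)
`= corank Sel_{p^∞}(E/ℚ)` (Mazur control, tree theorem
`Greenberg1999_coinvariantsRank_eq_selmerCorank_rat_holds`). A cyclotomic datum exists
(`exists_isCyclotomic_isTopGenerator_isCyclotomicVariable_holds`, `nonempty_selmerDualData_holds`).
[cite: GreenbergLNM1716, Thm. 1.2 and §1 p. 65] -/
theorem order_eq_selmerCorank_of_mc_ss_at :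
    ∀ (W : WeierstrassCurve ℚ) [W.IsElliptic] [W.IsGloballyMinimal] (p : ℕ) [Fact p.Prime],
      Literature.NumberTheory.EllipticCurves.IsOrdinaryAt W p →
      ∀ {N : ℕ} [NeZero N] (f : CuspForm (CongruenceSubgroup.Gamma0 N) 2),
      (∀ (κ : Literature.NumberTheory.EllipticCurves.ZpExtension ℚ p) (γ : Field.absoluteGaloisGroup ℚ),
        κ.IsCyclotomic → κ.IsTopGenerator γ →
        Literature.NumberTheory.EllipticCurves.IsCyclotomicVariable p γ →
        ∀ (D : W.SelmerDualData κ γ), D.IsTorsion ∧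
          ∃ (g : Literature.NumberTheory.EllipticCurves.IwasawaAlgebra p) (k : ℤ),
            D.charIdeal = Ideal.span {g} ∧
              Literature.NumberTheory.EllipticCurves.iwasawaToPowerSeries p g =
                PowerSeries.C ((p : ℚ_[p]) ^ k) *
                  Literature.NumberTheory.EllipticCurves.padicLFunction f
                    (Literature.NumberTheory.EllipticCurves.unitRoot W p : ℚ_[p])) →
      (∀ (κ : Literature.NumberTheory.EllipticCurves.ZpExtension ℚ p) (γ : Field.absoluteGaloisGroup ℚ),
        κ.IsCyclotomic → κ.IsTopGenerator γ → ∀ (D : W.SelmerDualData κ γ) (x : D.X),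
        (∃ k : ℕ, (PowerSeries.C ((p : ℤ_[p]) ^ k) * PowerSeries.X ^ 2 :
            Literature.NumberTheory.EllipticCurves.IwasawaAlgebra p) • x = 0) →
          ∃ k : ℕ, (PowerSeries.C ((p : ℤ_[p]) ^ k) * PowerSeries.X :
            Literature.NumberTheory.EllipticCurves.IwasawaAlgebra p) • x = 0) →
      (Literature.NumberTheory.EllipticCurves.padicLFunction f
        (Literature.NumberTheory.EllipticCurves.unitRoot W p : ℚ_[p])).order = W.selmerCorank p := by
  intro W _ _ p _ hord N _ f hmc hss
  obtain ⟨κ, hκ, γ, hγ, hγ'⟩ := exists_isCyclotomic_isTopGenerator_isCyclotomicVariable_holds p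
  obtain ⟨D⟩ := W.nonempty_selmerDualData_holds κ γ hγ
  obtain ⟨htors, hmc'⟩ := hmc κ γ hκ hγ hγ' D
  have hss' := stub_ker_mulTRat_sq_eq p D.X (hss κ γ hκ hγ D)
  have hctrl := (Greenberg1999_coinvariantsRank_eq_selmerCorank_rat_holds W p hord.1 hord.2 κ γ hκ hγ D).2
  exact stub_order_eq_selmerCorank W p κ γ hκ hγ f D htors hmc' hss' hctrl

/-- **Crux #2 at every ODD good ordinary prime from SIX route items, every analytic rank.** For
`E/ℚ` (globally minimal `W`), `p ≠ 2` good ordinary and the newform `f`: `ord_{T=0} L_p(E,T) = r_an`,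
assuming `SelmerRankLB`, `SelmerRankUB`, `SelmerRankSmallImage`, `SelmerRankShaPFinite` (Selmer side
`corank Sel_{p^∞} = r_an` at every `p`, landed `selmerCorank_eq_analyticRank_of_selmerRankItems`),
crux #4 `PAdicOrderSemisimpleR3` and crux #7 `PAdicOrderMainConjectureR7`:
`order_eq_selmerCorank_of_mc_ss_at` fed by the two items. Crux #5 (rank one) is not needed.
[cite: MazurTateTeitelbaum1986Invent, §II.10] [cite: GreenbergLNM1716, Thm. 1.2 and §1 p. 65] -/
theorem order_eq_analyticRank_odd_of_sixRouteItems :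
    Summit.BirchSwinnertonDyer.BirchSwinnertonDyer.Theses.SelmerRank.SelmerRankLB →
    Summit.BirchSwinnertonDyer.BirchSwinnertonDyer.Theses.SelmerRank.SelmerRankUB →
    Summit.BirchSwinnertonDyer.BirchSwinnertonDyer.Theses.SelmerRank.SelmerRankSmallImage →
    Summit.BirchSwinnertonDyer.BirchSwinnertonDyer.Theses.SelmerRank.SelmerRankShaPFinite →
    Summit.BirchSwinnertonDyer.BirchSwinnertonDyer.Theses.PAdicOrderV2.PAdicOrderSemisimpleR3 →
    Summit.BirchSwinnertonDyer.BirchSwinnertonDyer.Theses.PAdicOrderV2.PAdicOrderMainConjectureR7 →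
    ∀ (W : WeierstrassCurve ℚ) [W.IsElliptic] [W.IsGloballyMinimal] (p : ℕ) [Fact p.Prime],
      p ≠ 2 → Literature.NumberTheory.EllipticCurves.IsOrdinaryAt W p →
      ∀ {N : ℕ} [NeZero N] (f : CuspForm (CongruenceSubgroup.Gamma0 N) 2),
        Literature.NumberTheory.EllipticCurves.ModularForms.IsNewformOf W f →
          (Literature.NumberTheory.EllipticCurves.padicLFunction f
            (Literature.NumberTheory.EllipticCurves.unitRoot W p : ℚ_[p])).order = W.analyticRank := by
  intro hLB hUB hSI hSha hSS hMC W _ _ p _ hp2 hord N _ f hf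
  have hp3 : 3 ≤ p := by
    have := (Fact.out : p.Prime).two_le
    omega
  rw [← selmerCorank_eq_analyticRank_of_selmerRankItems hLB hUB hSI hSha W p]
  exact order_eq_selmerCorank_of_mc_ss_at W p hord f
    (fun κ γ hκ hγ hγ' D => hMC W p hp3 hord.1 hord.2 κ γ hκ hγ hγ' f hf D)
    (fun κ γ hκ hγ D x hx => hSS W p hp2 hord.1 hord.2 κ γ hκ hγ D x hx)

/-- **Crux #2 at every good ordinary `p ≥ 5` from FIVE route items, every analytic rank.** For
`E/ℚ` (globally minimal `W`), `p ≥ 5` good ordinary and the newform `f`: `ord_{T=0} L_p(E,T) = r_an`,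
assuming `SelmerRankLB`, `SelmerRankUB`, `SelmerRankSmallImage` (the Selmer side AT `p`:
`corank Sel_{p^∞} = r_an`, split on the surjectivity of `ρ̄_{E,p}`), crux #4 `PAdicOrderSemisimpleR3`
and crux #7 `PAdicOrderMainConjectureR7`. Neither `SelmerRankShaPFinite` nor crux #5 is needed on
the slice the thesis consumes (one good ordinary `p ≥ 5`).
[cite: MazurTateTeitelbaum1986Invent, §II.10] [cite: GreenbergLNM1716, Thm. 1.2 and §1 p. 65] -/
theorem order_eq_analyticRank_five_le_of_fiveRouteItems :
    Summit.BirchSwinnertonDyer.BirchSwinnertonDyer.Theses.SelmerRank.SelmerRankLB →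
    Summit.BirchSwinnertonDyer.BirchSwinnertonDyer.Theses.SelmerRank.SelmerRankUB →
    Summit.BirchSwinnertonDyer.BirchSwinnertonDyer.Theses.SelmerRank.SelmerRankSmallImage →
    Summit.BirchSwinnertonDyer.BirchSwinnertonDyer.Theses.PAdicOrderV2.PAdicOrderSemisimpleR3 →
    Summit.BirchSwinnertonDyer.BirchSwinnertonDyer.Theses.PAdicOrderV2.PAdicOrderMainConjectureR7 →
    ∀ (W : WeierstrassCurve ℚ) [W.IsElliptic] [W.IsGloballyMinimal] (p : ℕ) [Fact p.Prime],
      5 ≤ p → Literature.NumberTheory.EllipticCurves.IsOrdinaryAt W p →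
      ∀ {N : ℕ} [NeZero N] (f : CuspForm (CongruenceSubgroup.Gamma0 N) 2),
        Literature.NumberTheory.EllipticCurves.ModularForms.IsNewformOf W f →
          (Literature.NumberTheory.EllipticCurves.padicLFunction f
            (Literature.NumberTheory.EllipticCurves.unitRoot W p : ℚ_[p])).order = W.analyticRank := by
  intro hLB hUB hSI hSS hMC W _ _ p _ hp5 hord N _ f hf
  have hp2 : p ≠ 2 := by omega
  have hp3 : 3 ≤ p := by omega
  -- the Selmer side at `p ≥ 5`
  have hsel : W.selmerCorank p = W.analyticRank := by
    by_cases hs : W.HasSurjectiveModNGaloisRep p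
    · exact le_antisymm (hUB W p hp5 hord.1 hord.2 hs) (hLB W p hp5 hord.1 hord.2 hs)
    · exact hSI W p hp5 hord.1 hord.2 hs
  rw [← hsel]
  exact order_eq_selmerCorank_of_mc_ss_at W p hord f
    (fun κ γ hκ hγ hγ' D => hMC W p hp3 hord.1 hord.2 κ γ hκ hγ hγ' f hf D)
    (fun κ γ hκ hγ D x hx => hSS W p hp2 hord.1 hord.2 κ γ hκ hγ D x hx)

/-- **The `p = 2` residue of crux #2 from K2 and NE2⁺ at the point and route SelmerRank's items.**
For `E/ℚ` (globally minimal `W`) good ordinary at `p = 2` and the newform `f`, assume Kato's bound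
`corank_{ℤ_2} Sel_{2^∞}(E/ℚ) ≤ ord_{T=0} L_2(E,T)` (K2 at this point: Kato, Astérisque 295, Thm 18.4
as printed) and, in positive rank, no excess zeros `ord_{T=0} L_2(E,T) ≤ corank_{ℤ_2} Sel_{2^∞}(E/ℚ)`
(NE2⁺ at this point). With `corank Sel_2 = r_an` and `rank = r_an` (SelmerRank items):
`r_an = 0` ⇒ `L_2(E,0) ≠ 0` ⇒ `ord = 0` (interpolation, landed S1 `stub_constantCoeff_eq_zero_iff`);
`r_an ≥ 1`: `ord ≤ corank = r_an` (NE2⁺) and `r_an ≤ ord` by `L_2(E,0) = 0` (rank 1), parity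
(rank 2, landed L2 `stub_two_le_order_of_analyticRank_eq_two`), K2 (rank `≥ 3`).
[cite: MazurTateTeitelbaum1986Invent, §II.10] [cite: Kato2004Asterisque, Thm. 18.4 (p. 281)] -/
theorem order_eq_analyticRank_two_of_kato_noExcess :
    Summit.BirchSwinnertonDyer.BirchSwinnertonDyer.Theses.SelmerRank.SelmerRankLB →
    Summit.BirchSwinnertonDyer.BirchSwinnertonDyer.Theses.SelmerRank.SelmerRankUB →
    Summit.BirchSwinnertonDyer.BirchSwinnertonDyer.Theses.SelmerRank.SelmerRankSmallImage →
    Summit.BirchSwinnertonDyer.BirchSwinnertonDyer.Theses.SelmerRank.SelmerRankShaPFinite →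
    ∀ (W : WeierstrassCurve ℚ) [W.IsElliptic] [W.IsGloballyMinimal] (p : ℕ) [Fact p.Prime],
      p = 2 → Literature.NumberTheory.EllipticCurves.IsOrdinaryAt W p →
      ∀ {N : ℕ} [NeZero N] (f : CuspForm (CongruenceSubgroup.Gamma0 N) 2),
        Literature.NumberTheory.EllipticCurves.ModularForms.IsNewformOf W f →
        ((W.selmerCorank p : ℕ∞) ≤ (Literature.NumberTheory.EllipticCurves.padicLFunction f
            (Literature.NumberTheory.EllipticCurves.unitRoot W p : ℚ_[p])).order) →
        (1 ≤ W.mordellWeilRank →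
          (Literature.NumberTheory.EllipticCurves.padicLFunction f
            (Literature.NumberTheory.EllipticCurves.unitRoot W p : ℚ_[p])).order ≤ W.selmerCorank p) →
          (Literature.NumberTheory.EllipticCurves.padicLFunction f
            (Literature.NumberTheory.EllipticCurves.unitRoot W p : ℚ_[p])).order = W.analyticRank := by
  intro hLB hUB hSI hSha W _ _ p _ _hp2 hord N _ f hf hK hNE
  have h1 := stub_constantCoeff_eq_zero_iff W p hord f hf
  have hsel : W.selmerCorank p = W.analyticRank :=
    selmerCorank_eq_analyticRank_of_selmerRankItems hLB hUB hSI hSha W p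
  have hrk : W.mordellWeilRank = W.analyticRank :=
    mordellWeilRank_eq_analyticRank_of_selmerRankItems hLB hUB hSI hSha W
  rcases Nat.lt_or_ge W.analyticRank 1 with h0 | hpos
  · -- analytic rank 0: the constant term is a unit of ℚ_2, so the T-order is 0
    have hr : W.analyticRank = 0 := by omega
    have hc : PowerSeries.constantCoeff (Literature.NumberTheory.EllipticCurves.padicLFunction f
        (Literature.NumberTheory.EllipticCurves.unitRoot W p : ℚ_[p])) ≠ 0 := by
      intro h
      have := h1.mp h
      omega
    rw [hr, Nat.cast_zero]
    refine PowerSeries.order_eq_nat.mpr ⟨?_, fun i hi => (Nat.not_lt_zero i hi).elim⟩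
    simpa only [PowerSeries.coeff_zero_eq_constantCoeff] using hc
  · apply le_antisymm
    · -- upper bound: NE2⁺ (positive rank) and the Selmer side
      have hrk1 : 1 ≤ W.mordellWeilRank := by omega
      have h := hNE hrk1
      rwa [hsel] at h
    · -- lower bound
      rcases Nat.lt_or_ge W.analyticRank 2 with hlt2 | h2
      · -- analytic rank 1: `L_2(E,0) = 0`, so `1 ≤ ord`
        have hr : W.analyticRank = 1 := by omega
        have hc : PowerSeries.constantCoeff (Literature.NumberTheory.EllipticCurves.padicLFunction f
            (Literature.NumberTheory.EllipticCurves.unitRoot W p : ℚ_[p])) = 0 := h1.mpr (by omega)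
        have h1le : ((1 : ℕ) : ℕ∞) ≤ (Literature.NumberTheory.EllipticCurves.padicLFunction f
            (Literature.NumberTheory.EllipticCurves.unitRoot W p : ℚ_[p])).order := by
          refine PowerSeries.nat_le_order _ 1 fun i hi => ?_
          have hi0 : i = 0 := by omega
          subst hi0
          simpa only [PowerSeries.coeff_zero_eq_constantCoeff] using hc
        rw [hr]
        exact h1le
      · rcases Nat.lt_or_ge W.analyticRank 3 with hlt3 | _
        · -- analytic rank 2: parity
          have hr : W.analyticRank = 2 := by omega
          rw [hr, Nat.cast_ofNat]
          exact stub_two_le_order_of_analyticRank_eq_two W p hord f hf hr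
        · -- analytic rank ≥ 3: K2 and the Selmer side
          rwa [hsel] at hK

/-- **Crux #2 `PAdicOrderComparisonR2` BY NAME from six route items, Kato's Thm 18.4 at every prime
(K2) and no-excess-zeros at `p = 2` in positive rank (NE2⁺)** — the sorry-free form of the
composition `pAdicOrderComparisonR2_of_stubs` of skeleton v13 of line `Sketch`: the two last
hypotheses are VERBATIM the registered stubs `stub_katoAllPrimes` (the ∀-closure of the named fact
`kato_selmerCorank_le_order_padicLFunction_allPrimes`, literature debt) and `stub_noExcessTwoPos`
(open beyond print), both shared with crux #3's line (stmt-0490). Odd `p`: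
`order_eq_analyticRank_odd_of_sixRouteItems`; `p = 2`: `order_eq_analyticRank_two_of_kato_noExcess`.
Machine-checked content: crux #2 ⇐ {0131, 0130, 14418, 0132, 0509, 15426} ∧ K2 ∧ NE2⁺.
[cite: MazurTateTeitelbaum1986Invent, §II.10] [cite: Kato2004Asterisque, Thm. 18.4 (p. 281)] -/
theorem pAdicOrderComparisonR2_of_sixRouteItems_kato_noExcessTwo :
    Summit.BirchSwinnertonDyer.BirchSwinnertonDyer.Theses.SelmerRank.SelmerRankLB →
    Summit.BirchSwinnertonDyer.BirchSwinnertonDyer.Theses.SelmerRank.SelmerRankUB →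
    Summit.BirchSwinnertonDyer.BirchSwinnertonDyer.Theses.SelmerRank.SelmerRankSmallImage →
    Summit.BirchSwinnertonDyer.BirchSwinnertonDyer.Theses.SelmerRank.SelmerRankShaPFinite →
    Summit.BirchSwinnertonDyer.BirchSwinnertonDyer.Theses.PAdicOrderV2.PAdicOrderSemisimpleR3 →
    Summit.BirchSwinnertonDyer.BirchSwinnertonDyer.Theses.PAdicOrderV2.PAdicOrderMainConjectureR7 →
    (∀ (W : WeierstrassCurve ℚ) [W.IsElliptic] [W.IsGloballyMinimal] (p : ℕ) [Fact p.Prime]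
      {N : ℕ} [NeZero N] (f : CuspForm (CongruenceSubgroup.Gamma0 N) 2),
      Literature.NumberTheory.EllipticCurves.kato_selmerCorank_le_order_padicLFunction_allPrimes W p
        (f := f)) →
    (∀ (W : WeierstrassCurve ℚ) [W.IsElliptic] [W.IsGloballyMinimal] (p : ℕ) [Fact p.Prime],
      p = 2 → Literature.NumberTheory.EllipticCurves.IsOrdinaryAt W p →
      ∀ {N : ℕ} [NeZero N] (f : CuspForm (CongruenceSubgroup.Gamma0 N) 2),
        Literature.NumberTheory.EllipticCurves.ModularForms.IsNewformOf W f →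
      1 ≤ W.mordellWeilRank →
      (Literature.NumberTheory.EllipticCurves.padicLFunction f
        (Literature.NumberTheory.EllipticCurves.unitRoot W p : ℚ_[p])).order ≤ W.selmerCorank p) →
    Summit.BirchSwinnertonDyer.BirchSwinnertonDyer.Theses.PAdicOrderV2.PAdicOrderComparisonR2 := by
  intro hLB hUB hSI hSha hSS hMC hK2 hNE2 W _ _ p _ hord N _ f hf
  by_cases hp2 : p = 2
  · exact order_eq_analyticRank_two_of_kato_noExcess hLB hUB hSI hSha W p hp2 hord f hf
      (hK2 W p f hord hf) (hNE2 W p hp2 hord f hf)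
  · exact order_eq_analyticRank_odd_of_sixRouteItems hLB hUB hSI hSha hSS hMC W p hp2 hord f hf

end Summit.BirchSwinnertonDyer.BirchSwinnertonDyer.Theorems
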